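/-
Copyright: the b2b-balaban T⁴-continuum CRUX team, row NE7b OWNER lineage `t4-ne7b-p1` (gen 122). Project licence.
-/
import Summits.QuantumFields.BalabanUV.T4Continuum.Spine.NE7b.SupTorusSupNormRoad
import Summits.QuantumFields.BalabanUV.T4Continuum.Spine.NE7b.SupTorusPointwiseDecayRoad

/-!
# `H_V⁻¹f` IS SMOOTH AT THE BLOCK SCALE ON THE ROAD'S CLASS `−λ ≤ V ≤ Λ`, `d ≥ 3`: the fine-lattice GRADIENT costs one lattice spacing in
# block units — `(n+1)·|u(x + ê_μ) − u(x)| ≤ C·‖f‖_∞` for EVERY source, and `e^{δρ_s(bt x, y₀)}·(n+1)·|u(x + ê_μ) − u(x)| ≤ C·M` for sources with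
# the profile `|f| ≤ M·e^{−γρ_s(bt ·, y₀)}` — the GRADIENT half of the tree's interior estimate (`Beta.PoissonInterior.interior_estimate`,
# `|u(x+e_j) − u x| ≤ C(d)(m·sup_{cube}|Δu| + m^{−(d+1)}Σ_{cube}|u|)`) read on the periodic lift with the sup bounds of (152)∕(154) as input
# (row NE7b, node U5c; (151)–(154) BY NAME; [folklore])

Cell `pub-balaban`, sub-cell `t4`, spine estimate NE7b (`T4WeightBudget.RelWeightBound`; the cell's OWN estimate — NOT PRINTED in
[Bałaban 1983–89], NOT PROVED).  Crux-route work under `Spine/NE7b/` by the row OWNER (`t4-ne7b-p1` gen 122, file (156)) under FREEZE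
(0)'s crux-prover clause; NOTHING of Bałaban's is named as a Lean object, valued or asserted; no `T4Continuum/Support` leaf typed; no `def`,
no notation (the action DISPLAYED exactly as in (133)–(155)); zero `sorry`.  Imports (BY NAME): the OWNER's (152) `…SupTorusSupNormRoad`
(`supNorm_bound_road`) and (154) `…SupTorusPointwiseDecayRoad` (`pointwise_decay_road`; through them (153), (151), (149), (148), (131), the
torus dictionary and the β-team's `Beta.PoissonInterior.interior_estimate`).

WHY (located).  A renormalisation-group step needs the fields SMOOTH on the block scale (derivative terms of the next action); the sup road
has it on `ℤ^d` ((75) `SupBackgroundGradient`), the torus `ℓ²` road had no gradient letter.  The interior estimate's second conclusion is a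
gradient bound with one power of `m ≈ θ(n+1)` less: with the cube data of (152)∕(154) (`|Δ(u∘σ)|` from (153) `laplacian_site_le`, `Σ_{cube}|u∘σ|`
from the block-`ℓ¹` letters) and the sup bounds of (152)∕(154) as INPUT (no absorption), `(n+1)|u(x+ê) − u(x)| ≤ C(d)(θ(…) + 3^d·Cd·6^{d+1}M)`
(`θ = 1∕3`), every term carrying `e^{dδ}e^{−δρ_s(bt x, y₀)}` in the weighted case; meshes with `n+1 < 6` are read off the sup bounds directly;
a fine unit step moves the block by at most `ρ_s`-distance `d` (§1).

WHAT IS PROVED ([folklore]; fine torus `Site d ((n+1)s)`, coarse `Site d s`, `[NeZero s]`; the action DISPLAYED; `σ = siteOf`, `ê_μ = σ(e μ)`,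
`bt x = σ_s(blk n (wm x))`, `ρ_s` the `ℓ¹` circular distance; `d ≥ 3`, `a > 0`, `λ < min(2,a)`, `Λ ≥ 0` throughout):
* §1 `blk_step_near`, `bt_step_dist_le` (`ρ_s(bt(x + ê_μ), bt x) ≤ d`).
* §2 **`gradient_bound_road`**: `∃ C > 0`: ALL `n, s`, ALL `−λ ≤ V ≤ Λ`, EVERY `|f| ≤ M`, every `Hu = f`, `x, μ`: `(n+1)·|u(x + ê_μ) − u(x)| ≤ C·M`.
* §3 **`gradient_decay_road`**: `γ > 0` ⟹ `∃ C δ > 0`: ALL `n, s`, ALL `−λ ≤ V ≤ Λ`, every `y₀`, EVERY `|f| ≤ M·e^{−γρ_s(bt ·, y₀)}`, every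
  `Hu = f`, `x, μ`: `e^{δρ_s(bt x, y₀)}·(n+1)·|u(x + ê_μ) − u(x)| ≤ C·M`.
* §4 toy (`d = 3`).

HONEST (what this is NOT).  First differences only (a same-direction second difference of the same quality would need lit1's third-difference
envelope of `G₀`, flagged in `PoissonInterior`); `d ≥ 3` only; constants existential and far from sharp; cubic periods; scalar skeleton ((A3),
NC-NE7b-α UNRULED); nothing of the covariant propagators of [B4]–[B6]; nothing of Bałaban's.  BY-NAME EFFECT ON THE WALL: NONE.  NE7b NOT
PRINTED ∕ NOT PROVED; spine PROVED 0∕9; rung (B)+1 on a FINITE torus — NOT infinite volume, NOT the mass gap, NOT Clay.  HONEST DEPENDENCY: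
continuum YM on T⁴ ⇐ BetaPertH ∧ nine spine estimates (0∕9 proved); BetaPertH ⇐ (D1) ∧ (D4) ∧ CAP+tail; G-an2-4 gates asym, D1 and NE2∕3∕4.
-/

set_option autoImplicit false

noncomputable section

namespace Summit.QuantumFields.BalabanUV.T4Continuum.NE7b.SupTorusGradientRoad

open Real
open Literature.MathematicalPhysics.QuantumFieldTheory.Balaban1983to89
open Literature.Probability.LatticeModels (latticeLaplacianZd)
open B6QGQLower276 (X e blk B side chart mem_B sum_B sum_B_const card_cube blk_chart side_facts)
open Beta (Site siteOf windowMap siteOf_windowMap siteOf_add siteOf_sub)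
open Beta.PoissonInterior (cube mem_cube interior_estimate)
open SupTorusDirichletForm (siteOf_chart_surjective blockOf_siteOf_of_mem blockOf_siteOf)
open SupTorusDirichletFormCoercive (comp_siteOf_periodic)
open PeriodicSupTorusCarrier (exists_windowMap_siteOf)
open OneShotChartTorusRowsZd (sum_B_translate)
open SupTorusHessianCombesThomas (exists_rate)
open SupTorusBlockDistance (isPseudoDist_torus)
open SupTorusSupNormBound (exists_blockColumns blockMean_le_sup)
open SupTorusPointwiseProfile (blockMean_le_of_supProfile)
open SupTorusBlockL1Letter (lap_lift blockL1_le_sup_lattice blk_near_of_mem_cube sum_cube_le)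
open SupTorusBlockL1Profile (blockL1_le_of_supProfile near_dist_le sum_cube_le_of_near laplacian_site_le)
open SupTorusSupNormRoad (supNorm_bound_road)
open SupTorusPointwiseDecayRoad (pointwise_decay_road)

variable {d : ℕ}

/-! ## §1. A fine unit step moves the block by at most one -/

/-- A unit step in `ℤ^d` moves every block coordinate by at most one. [folklore] -/
theorem blk_step_near (n : ℕ) (q : X d) (μ i : Fin d) : blk n q i - 1 ≤ blk n (q + e μ) i ∧ blk n (q + e μ) i ≤ blk n q i + 1 := by
  have hs : (0 : ℤ) < side n := (side_facts n).1
  have hs1 : (1 : ℤ) ≤ side n := (side_facts n).2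
  show q i / side n - 1 ≤ (q + e μ) i / side n ∧ (q + e μ) i / side n ≤ q i / side n + 1
  have hqi : (q + e μ) i = q i + (if i = μ then 1 else 0) := by
    simp only [e, Pi.add_apply, Pi.single_apply]
  rw [hqi]
  have e1 : (q i + 1 * side n) / side n = q i / side n + 1 := Int.add_mul_ediv_right _ _ hs.ne'
  have k0 : q i / side n ≤ (q i + (if i = μ then 1 else 0)) / side n := Int.ediv_le_ediv hs (by split_ifs <;> linarith)
  have k1 : (q i + (if i = μ then 1 else 0)) / side n ≤ (q i + 1 * side n) / side n := Int.ediv_le_ediv hs (by split_ifs <;> linarith)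
  rw [e1] at k1
  constructor <;> linarith

/-- **A FINE UNIT STEP MOVES THE TORUS BLOCK BY AT MOST `ρ_s`-DISTANCE `d`**: `ρ_s(bt(x + ê_μ), bt x) ≤ d`. [folklore] -/
theorem bt_step_dist_le (n s : ℕ) [NeZero s] (x : Site d ((n + 1) * s)) (μ : Fin d) :
    ∑ i, ((((siteOf d s (blk n (windowMap d ((n + 1) * s) (x + siteOf d ((n + 1) * s) (e μ))))) i
        - (siteOf d s (blk n (windowMap d ((n + 1) * s) x))) i).valMinAbs.natAbs : ℕ) : ℝ) ≤ d := by
  have hx : x + siteOf d ((n + 1) * s) (e μ) = siteOf d ((n + 1) * s) (windowMap d ((n + 1) * s) x + e μ) := by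
    rw [siteOf_add, siteOf_windowMap]
  rw [hx, blockOf_siteOf]
  exact near_dist_le s (blk_step_near n (windowMap d ((n + 1) * s) x) μ)

/-! ## §2. The gradient for every bounded source -/

/-- **HEADLINE (every source) — `(n+1)·|u(x + ê_μ) − u(x)| ≤ C·‖f‖_∞` ON THE ROAD'S CLASS `−λ ≤ V ≤ Λ`, `d ≥ 3`, every mesh, every volume.**
`∃ C > 0` (from `(d, a, λ, Λ)` and `C(d)`) such that for ALL `n, s`, ALL `−λ ≤ V ≤ Λ`, EVERY `f` with `|f| ≤ M`, every `Hu = f` (displayed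
action), every site `x` and direction `μ`: the increment over one fine bond is `≤ C·M∕(n+1)`.  The gradient half of `interior_estimate` on the
periodic lift with (152)'s cube data and (152) `supNorm_bound_road` as input. [folklore] -/
theorem gradient_bound_road (hd : 3 ≤ d) (a : ℝ) (ha : 0 < a) {lam Lam : ℝ} (hlam : lam < min 2 a) (hLam : 0 ≤ Lam) :
    ∃ C : ℝ, 0 < C ∧ ∀ (n s : ℕ) [NeZero s] (V : Site d ((n + 1) * s) → ℝ), (∀ x, -lam ≤ V x) → (∀ x, V x ≤ Lam) →
      ∀ (M : ℝ) (u f : Site d ((n + 1) * s) → ℝ), (∀ x, |f x| ≤ M) →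
      (∀ x, ((n : ℝ) + 1) ^ 2 * ∑ μ, (2 * u x - u (x + siteOf d ((n + 1) * s) (e μ)) - u (x - siteOf d ((n + 1) * s) (e μ)))
        + a / ((n : ℝ) + 1) ^ d * ∑ q ∈ B n (blk n (windowMap d ((n + 1) * s) x)), u (siteOf d ((n + 1) * s) q) + V x * u x = f x) →
      ∀ (x : Site d ((n + 1) * s)) (μ : Fin d), ((n : ℝ) + 1) * |u (x + siteOf d ((n + 1) * s) (e μ)) - u x| ≤ C * M := by
  classical
  have hdR : (0 : ℝ) ≤ d := Nat.cast_nonneg d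
  have hm0 : 0 < min 2 a - lam := by linarith
  obtain ⟨κ, hκ0, hκ1, hκm⟩ := exists_rate (d := d) a ha.le hm0
  have hm : 0 < min 2 a - lam - 2 * d * κ ^ 2 - a * (exp (2 * d * κ) - 1) := by linarith
  set m := min 2 a - lam - 2 * d * κ ^ 2 - a * (exp (2 * d * κ) - 1) with hm_def
  set K : ℝ := (2 * (1 - exp (-κ))⁻¹) ^ d with hK
  have hK0 : 0 ≤ K := pow_nonneg (mul_nonneg zero_le_two (inv_nonneg.2 (sub_nonneg.2 (exp_le_one_iff.2 (by linarith))))) d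
  have hminv : 0 ≤ m⁻¹ := inv_nonneg.2 hm.le
  set Cd : ℝ := m⁻¹ * exp (2 * d * κ) * K with hCd
  have hCd0 : 0 ≤ Cd := by positivity
  obtain ⟨CI, hCI0, hI⟩ := interior_estimate hd
  obtain ⟨C₀, hC₀, H0⟩ := supNorm_bound_road (d := d) hd a ha hlam hLam
  set L : ℝ := |lam| + Lam with hL
  have hL0 : 0 ≤ L := by positivity
  set K₁ : ℝ := 6 * (2 * C₀) with hK₁
  set K₂ : ℝ := CI * ((1 / 3) * (1 + L * C₀ + a * Cd) + 3 ^ d * Cd * 6 ^ (d + 1)) with hK₂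
  refine ⟨max K₁ K₂ + 1, by positivity, ?_⟩
  intro n s _ V hV hV' M u f hfM hu x μ
  have hM : 0 ≤ M := (abs_nonneg _).trans (hfM x)
  have hn1 : (0 : ℝ) < (n : ℝ) + 1 := by positivity
  have hVabs : ∀ x', |V x'| ≤ L := fun x' => by
    rw [hL, abs_le]; constructor <;> linarith [hV x', hV' x', le_abs_self lam, neg_abs_le lam]
  have hS : ∀ x', |u x'| ≤ C₀ * M := H0 n s V hV hV' M u f hfM hu
  suffices hmain : ((n : ℝ) + 1) * |u (x + siteOf d ((n + 1) * s) (e μ)) - u x| ≤ max K₁ K₂ * M by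
    refine hmain.trans ?_; rw [add_mul, one_mul]; linarith
  by_cases hsmall : (1 / 3 : ℝ) * ((n : ℝ) + 1) < 2
  · -- small meshes: `(n+1) < 6`
    have h1 : |u (x + siteOf d ((n + 1) * s) (e μ)) - u x| ≤ 2 * C₀ * M := by
      refine (abs_sub _ _).trans ?_; linarith [hS (x + siteOf d ((n + 1) * s) (e μ)), hS x]
    have h2 : (n : ℝ) + 1 ≤ 6 := by linarith
    calc ((n : ℝ) + 1) * |u (x + siteOf d ((n + 1) * s) (e μ)) - u x| ≤ 6 * (2 * C₀ * M) :=
          mul_le_mul h2 h1 (abs_nonneg _) (by norm_num)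
      _ = K₁ * M := by rw [hK₁]; ring
      _ ≤ max K₁ K₂ * M := mul_le_mul_of_nonneg_right (le_max_left _ _) hM
  · -- large meshes: the gradient half of the interior estimate at radius `3m`, `m = ⌊(n+1)∕3⌋`
    have hsmall' : 2 ≤ (1 / 3 : ℝ) * ((n : ℝ) + 1) := not_lt.1 hsmall
    set mm : ℕ := ⌊(1 / 3 : ℝ) * ((n : ℝ) + 1)⌋₊ with hmm
    have hmm_le : (mm : ℝ) ≤ (1 / 3) * ((n : ℝ) + 1) := Nat.floor_le (by positivity)
    have hmm_ge : (1 / 3 : ℝ) * ((n : ℝ) + 1) / 2 ≤ mm := by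
      have := Nat.lt_floor_add_one ((1 / 3 : ℝ) * ((n : ℝ) + 1)); rw [← hmm] at this; linarith
    have hmm2 : 2 ≤ mm := Nat.le_floor (by exact_mod_cast hsmall')
    have hmm1 : 1 ≤ mm := le_trans (by norm_num) hmm2
    have hmmR : (0 : ℝ) < mm := by exact_mod_cast (lt_of_lt_of_le zero_lt_one hmm1)
    have h3m : 3 * mm ≤ n + 1 := by exact_mod_cast (show ((3 * mm : ℕ) : ℝ) ≤ ((n + 1 : ℕ) : ℝ) by push_cast; linarith)
    obtain ⟨ψ, hψ⟩ := exists_blockColumns n a s ha.le hm0 V hV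
    have hmean : ∀ y : Site d s, |(((n : ℝ) + 1) ^ d)⁻¹ * ∑ z : Fin d → Fin (n + 1), u (siteOf d ((n + 1) * s) (chart n (windowMap d s y) z))|
        ≤ Cd * M * 1 := fun y => by
      have h := blockMean_le_sup n a s ha.le hκ0 hκ1 hm V hV ψ hψ u f hu hfM y
      rw [hCd, mul_one]; exact h
    have hL1 : ∀ b : X d, ∑ q ∈ B n b, |u (siteOf d ((n + 1) * s) q)| ≤ ((n : ℝ) + 1) ^ d * Cd * M := fun b => by
      have h := blockL1_le_sup_lattice n a s ha.le hκ0 hκ1 hm V hV u f hu hfM b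
      rw [hCd]; linarith [h]
    set q₀ : X d := windowMap d ((n + 1) * s) x with hq₀
    obtain ⟨A, hA⟩ : ∃ A : ℝ, A = 1 * (M + L * (C₀ * M) + a * (Cd * M)) / ((n : ℝ) + 1) ^ 2 := ⟨_, rfl⟩
    obtain ⟨Bsum, hB⟩ : ∃ Bsum : ℝ, Bsum = 3 ^ d * (((n : ℝ) + 1) ^ d * Cd * M) := ⟨_, rfl⟩
    have hlap : ∀ p ∈ cube q₀ (3 * mm), |latticeLaplacianZd (fun p' : X d => u (siteOf d ((n + 1) * s) p')) p| ≤ A := by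
      intro p _
      rw [lap_lift, abs_neg]
      obtain ⟨⟨y', z'⟩, hyz'⟩ := siteOf_chart_surjective n s (siteOf d ((n + 1) * s) p)
      simp only at hyz'
      rw [← hyz', hA]
      refine laplacian_site_le n a s ha.le hL0 V u f hu y' z' (hVabs _) ?_ ?_ (hmean y')
      · rw [mul_one]; exact hfM _
      · rw [one_mul]; exact hS _
    have hl1 : ∑ p ∈ cube q₀ (3 * mm), |u (siteOf d ((n + 1) * s) p)| ≤ Bsum := by
      rw [hB]; exact sum_cube_le h3m q₀ (F := fun p => |u (siteOf d ((n + 1) * s) p)|) (fun _ => abs_nonneg _) hL1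
    have hint0 := (hI mm hmm1 (fun p' : X d => u (siteOf d ((n + 1) * s) p')) q₀ A Bsum hlap hl1).2 μ
    have e2 : siteOf d ((n + 1) * s) q₀ = x := by rw [hq₀, siteOf_windowMap]
    have e3 : siteOf d ((n + 1) * s) (q₀ + Pi.single μ 1) = x + siteOf d ((n + 1) * s) (e μ) := by rw [siteOf_add, e2]; rfl
    have hint : |u (x + siteOf d ((n + 1) * s) (e μ)) - u x| ≤ CI * ((mm : ℝ) * A + Bsum / (mm : ℝ) ^ (d + 1)) := by rw [← e3, ← e2]; exact hint0
    -- sizes: `(n+1)·m·A ≤ θ(…)`, `(n+1)·Bsum∕m^{d+1} ≤ 3^d·Cd·(2∕θ)^{d+1}·M`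
    have hX0 : 0 ≤ M + L * (C₀ * M) + a * (Cd * M) := by positivity
    have hmA : ((n : ℝ) + 1) * ((mm : ℝ) * A) ≤ (1 / 3) * (M + L * (C₀ * M) + a * (Cd * M)) := by
      have h2 : ((n : ℝ) + 1) * (mm : ℝ) / ((n : ℝ) + 1) ^ 2 ≤ 1 / 3 := by
        rw [div_le_iff₀ (by positivity)]; have := mul_le_mul_of_nonneg_left hmm_le hn1.le; linarith
      calc ((n : ℝ) + 1) * ((mm : ℝ) * A) = ((n : ℝ) + 1) * (mm : ℝ) / ((n : ℝ) + 1) ^ 2 * (M + L * (C₀ * M) + a * (Cd * M)) := by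
            rw [hA]; ring
        _ ≤ _ := mul_le_mul_of_nonneg_right h2 hX0
    have hmB : ((n : ℝ) + 1) * (Bsum / (mm : ℝ) ^ (d + 1)) ≤ 3 ^ d * Cd * 6 ^ (d + 1) * M := by
      have hr : (n : ℝ) + 1 ≤ 6 * mm := by linarith
      have h1 : ((n : ℝ) + 1) ^ (d + 1) ≤ (6 : ℝ) ^ (d + 1) * (mm : ℝ) ^ (d + 1) := by rw [← mul_pow]; exact pow_le_pow_left₀ hn1.le hr _
      have h2 : ((n : ℝ) + 1) ^ (d + 1) / (mm : ℝ) ^ (d + 1) ≤ (6 : ℝ) ^ (d + 1) := by rwa [div_le_iff₀ (by positivity)]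
      calc ((n : ℝ) + 1) * (Bsum / (mm : ℝ) ^ (d + 1)) = 3 ^ d * Cd * M * (((n : ℝ) + 1) ^ (d + 1) / (mm : ℝ) ^ (d + 1)) := by
            rw [hB, pow_succ]; ring
        _ ≤ 3 ^ d * Cd * M * (6 : ℝ) ^ (d + 1) := mul_le_mul_of_nonneg_left h2 (by positivity)
        _ = _ := by ring
    calc ((n : ℝ) + 1) * |u (x + siteOf d ((n + 1) * s) (e μ)) - u x|
        ≤ ((n : ℝ) + 1) * (CI * ((mm : ℝ) * A + Bsum / (mm : ℝ) ^ (d + 1))) := mul_le_mul_of_nonneg_left hint hn1.le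
      _ = CI * (((n : ℝ) + 1) * ((mm : ℝ) * A) + ((n : ℝ) + 1) * (Bsum / (mm : ℝ) ^ (d + 1))) := by ring
      _ ≤ CI * ((1 / 3) * (M + L * (C₀ * M) + a * (Cd * M)) + 3 ^ d * Cd * 6 ^ (d + 1) * M) :=
          mul_le_mul_of_nonneg_left (add_le_add hmA hmB) hCI0
      _ = K₂ * M := by rw [hK₂]; ring
      _ ≤ max K₁ K₂ * M := mul_le_mul_of_nonneg_right (le_max_right _ _) hM

/-! ## §3. The gradient for sources with an exponential sup profile -/

/-- **HEADLINE (profile sources) — `e^{δρ_s(bt x, y₀)}·(n+1)·|u(x + ê_μ) − u(x)| ≤ C·M` ON THE ROAD'S CLASS `−λ ≤ V ≤ Λ`, `d ≥ 3`, every mesh,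
every volume**, for `|f| ≤ M·e^{−γρ_s(bt ·, y₀)}` and `Hu = f`: the gradient half of `interior_estimate` on the periodic lift with (154)'s
weighted cube data and (154) `pointwise_decay_road` as input; every block met is within `ρ_s`-distance `d` of `bt x` ((153) `near_dist_le`,
§1 `bt_step_dist_le`). [folklore] -/
theorem gradient_decay_road (hd : 3 ≤ d) (a : ℝ) (ha : 0 < a) {lam Lam γ : ℝ} (hlam : lam < min 2 a) (hLam : 0 ≤ Lam) (hγ : 0 < γ) :
    ∃ C δ : ℝ, 0 < C ∧ 0 < δ ∧ ∀ (n s : ℕ) [NeZero s] (V : Site d ((n + 1) * s) → ℝ), (∀ x, -lam ≤ V x) → (∀ x, V x ≤ Lam) →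
      ∀ (y₀ : Site d s) (M : ℝ) (u f : Site d ((n + 1) * s) → ℝ),
      (∀ x, |f x| ≤ M * exp (-(γ * ∑ i, ((((siteOf d s (blk n (windowMap d ((n + 1) * s) x))) i - y₀ i).valMinAbs.natAbs : ℕ) : ℝ)))) →
      (∀ x, ((n : ℝ) + 1) ^ 2 * ∑ μ, (2 * u x - u (x + siteOf d ((n + 1) * s) (e μ)) - u (x - siteOf d ((n + 1) * s) (e μ)))
        + a / ((n : ℝ) + 1) ^ d * ∑ q ∈ B n (blk n (windowMap d ((n + 1) * s) x)), u (siteOf d ((n + 1) * s) q) + V x * u x = f x) →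
      ∀ (x : Site d ((n + 1) * s)) (μ : Fin d),
        exp (δ * ∑ i, ((((siteOf d s (blk n (windowMap d ((n + 1) * s) x))) i - y₀ i).valMinAbs.natAbs : ℕ) : ℝ))
          * (((n : ℝ) + 1) * |u (x + siteOf d ((n + 1) * s) (e μ)) - u x|) ≤ C * M := by
  classical
  have hdR : (0 : ℝ) ≤ d := Nat.cast_nonneg d
  have hm0 : 0 < min 2 a - lam := by linarith
  obtain ⟨κ, hκ0, hκ1, hκm⟩ := exists_rate (d := d) a ha.le hm0
  have hm : 0 < min 2 a - lam - 2 * d * κ ^ 2 - a * (exp (2 * d * κ) - 1) := by linarith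
  set m := min 2 a - lam - 2 * d * κ ^ 2 - a * (exp (2 * d * κ) - 1) with hm_def
  have hminv : 0 ≤ m⁻¹ := inv_nonneg.2 hm.le
  -- the profile rate `δ₁ = min(κ, γ∕2)` of the block data, (154)'s rate `δ₂`, and `δ = min(δ₁, δ₂)`
  set δ₁ : ℝ := min κ (γ / 2) with hδ₁_def
  have hδ₁0 : 0 < δ₁ := lt_min hκ0 (by linarith)
  have hδ₁κ : δ₁ ≤ κ := min_le_left _ _
  have h2δ₁ : 2 * δ₁ ≤ γ := by have := min_le_right κ (γ / 2); rw [← hδ₁_def] at this; linarith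
  set K : ℝ := (2 * (1 - exp (-δ₁))⁻¹) ^ d with hK
  have hK0 : 0 ≤ K := pow_nonneg (mul_nonneg zero_le_two (inv_nonneg.2 (sub_nonneg.2 (exp_le_one_iff.2 (by linarith))))) d
  set Cd : ℝ := m⁻¹ * exp (2 * d * κ) * K with hCd
  have hCd0 : 0 ≤ Cd := by positivity
  obtain ⟨C₀, δ₂, hC₀, hδ₂, H0⟩ := pointwise_decay_road (d := d) hd a ha hlam hLam hγ
  set δ : ℝ := min δ₁ δ₂ with hδ_def
  have hδ0 : 0 < δ := lt_min hδ₁0 hδ₂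
  have hδδ₁ : δ ≤ δ₁ := min_le_left _ _
  have hδδ₂ : δ ≤ δ₂ := min_le_right _ _
  have hδγ : δ ≤ γ := by linarith
  set E : ℝ := exp (d * δ) with hE
  have hE1 : 1 ≤ E := one_le_exp (by positivity)
  obtain ⟨CI, hCI0, hI⟩ := interior_estimate hd
  set L : ℝ := |lam| + Lam with hL
  have hL0 : 0 ≤ L := by positivity
  set K₁ : ℝ := 6 * ((E + 1) * C₀) with hK₁
  set K₂ : ℝ := CI * E * ((1 / 3) * (1 + L * C₀ + a * Cd) + 3 ^ d * Cd * 6 ^ (d + 1)) with hK₂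
  refine ⟨max K₁ K₂ + 1, δ, by positivity, hδ0, ?_⟩
  intro n s _ V hV hV' y₀ M u f hf hu x μ
  have hP := isPseudoDist_torus (d := d) s
  have hM : 0 ≤ M := by
    have h1 := (abs_nonneg _).trans (hf x)
    exact le_of_mul_le_mul_right (by rw [zero_mul]; exact h1) (exp_pos _)
  have hn1 : (0 : ℝ) < (n : ℝ) + 1 := by positivity
  have hVabs : ∀ x', |V x'| ≤ L := fun x' => by
    rw [hL, abs_le]; constructor <;> linarith [hV x', hV' x', le_abs_self lam, neg_abs_le lam]
  -- (154) as input, at the smaller rate `δ`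
  have hS : ∀ x', |u x'| ≤ exp (-(δ * ∑ i, ((((siteOf d s (blk n (windowMap d ((n + 1) * s) x'))) i - y₀ i).valMinAbs.natAbs : ℕ) : ℝ)))
      * (C₀ * M) := fun x' => by
    have h := H0 n s V hV hV' y₀ M u f hf hu x'
    have hρ : 0 ≤ ∑ i, ((((siteOf d s (blk n (windowMap d ((n + 1) * s) x'))) i - y₀ i).valMinAbs.natAbs : ℕ) : ℝ) :=
      Finset.sum_nonneg fun _ _ => Nat.cast_nonneg _
    rw [exp_neg, ← div_eq_inv_mul, le_div_iff₀ (exp_pos _), mul_comm]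
    refine le_trans ?_ h
    refine mul_le_mul_of_nonneg_right (exp_le_exp.2 ?_) (abs_nonneg _)
    exact mul_le_mul_of_nonneg_right hδδ₂ hρ
  set ρx : ℝ := ∑ i, ((((siteOf d s (blk n (windowMap d ((n + 1) * s) x))) i - y₀ i).valMinAbs.natAbs : ℕ) : ℝ) with hρx
  -- the profile factor of a block within `ρ_s`-distance `d` of `bt x`
  have hfac : ∀ y' : Site d s, ∑ i, (((y' i - (siteOf d s (blk n (windowMap d ((n + 1) * s) x))) i).valMinAbs.natAbs : ℕ) : ℝ) ≤ d →
      exp (-(δ * ∑ i, (((y' i - y₀ i).valMinAbs.natAbs : ℕ) : ℝ))) ≤ E * exp (-(δ * ρx)) := fun y' hy' => by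
    have htri : ρx ≤ ∑ i, ((((siteOf d s (blk n (windowMap d ((n + 1) * s) x))) i - y' i).valMinAbs.natAbs : ℕ) : ℝ)
        + ∑ i, (((y' i - y₀ i).valMinAbs.natAbs : ℕ) : ℝ) := hP.triangle _ y' y₀
    have hsymm : ∑ i, ((((siteOf d s (blk n (windowMap d ((n + 1) * s) x))) i - y' i).valMinAbs.natAbs : ℕ) : ℝ)
        = ∑ i, (((y' i - (siteOf d s (blk n (windowMap d ((n + 1) * s) x))) i).valMinAbs.natAbs : ℕ) : ℝ) := hP.symm _ y'
    rw [hE, ← exp_add]; rw [hsymm] at htri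
    exact exp_le_exp.2 (by linarith [mul_le_mul_of_nonneg_left htri hδ0.le, mul_le_mul_of_nonneg_left hy' hδ0.le])
  suffices hmain : exp (δ * ρx) * (((n : ℝ) + 1) * |u (x + siteOf d ((n + 1) * s) (e μ)) - u x|) ≤ max K₁ K₂ * M by
    refine hmain.trans ?_; rw [add_mul, one_mul]; linarith
  have hw0 : exp (δ * ρx) * exp (-(δ * ρx)) = 1 := by rw [← exp_add, add_neg_cancel, exp_zero]
  -- the two values entering the increment carry `E·e^{−δρx}`
  have hux0 : |u x| ≤ exp (-(δ * ρx)) * (C₀ * M) := by rw [hρx]; exact hS x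
  have hux1 : |u (x + siteOf d ((n + 1) * s) (e μ))| ≤ E * exp (-(δ * ρx)) * (C₀ * M) :=
    (hS _).trans (mul_le_mul_of_nonneg_right (hfac _ (bt_step_dist_le n s x μ)) (by positivity))
  by_cases hsmall : (1 / 3 : ℝ) * ((n : ℝ) + 1) < 2
  · -- small meshes
    have h2 : (n : ℝ) + 1 ≤ 6 := by linarith
    have h1 : |u (x + siteOf d ((n + 1) * s) (e μ)) - u x| ≤ (E + 1) * (exp (-(δ * ρx)) * (C₀ * M)) := by
      refine (abs_sub _ _).trans ?_
      linarith
    calc exp (δ * ρx) * (((n : ℝ) + 1) * |u (x + siteOf d ((n + 1) * s) (e μ)) - u x|)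
        ≤ exp (δ * ρx) * (6 * ((E + 1) * (exp (-(δ * ρx)) * (C₀ * M)))) :=
          mul_le_mul_of_nonneg_left (mul_le_mul h2 h1 (abs_nonneg _) (by norm_num)) (exp_pos _).le
      _ = (exp (δ * ρx) * exp (-(δ * ρx))) * (K₁ * M) := by rw [hK₁]; ring
      _ = K₁ * M := by rw [hw0, one_mul]
      _ ≤ max K₁ K₂ * M := mul_le_mul_of_nonneg_right (le_max_left _ _) hM
  · -- large meshes
    have hsmall' : 2 ≤ (1 / 3 : ℝ) * ((n : ℝ) + 1) := not_lt.1 hsmall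
    set mm : ℕ := ⌊(1 / 3 : ℝ) * ((n : ℝ) + 1)⌋₊ with hmm
    have hmm_le : (mm : ℝ) ≤ (1 / 3) * ((n : ℝ) + 1) := Nat.floor_le (by positivity)
    have hmm_ge : (1 / 3 : ℝ) * ((n : ℝ) + 1) / 2 ≤ mm := by
      have := Nat.lt_floor_add_one ((1 / 3 : ℝ) * ((n : ℝ) + 1)); rw [← hmm] at this; linarith
    have hmm2 : 2 ≤ mm := Nat.le_floor (by exact_mod_cast hsmall')
    have hmm1 : 1 ≤ mm := le_trans (by norm_num) hmm2
    have hmmR : (0 : ℝ) < mm := by exact_mod_cast (lt_of_lt_of_le zero_lt_one hmm1)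
    have h3m : 3 * mm ≤ n + 1 := by exact_mod_cast (show ((3 * mm : ℕ) : ℝ) ≤ ((n + 1 : ℕ) : ℝ) by push_cast; linarith)
    obtain ⟨ψ, hψ⟩ := exists_blockColumns n a s ha.le hm0 V hV
    have hmean : ∀ y : Site d s, |(((n : ℝ) + 1) ^ d)⁻¹ * ∑ z : Fin d → Fin (n + 1), u (siteOf d ((n + 1) * s) (chart n (windowMap d s y) z))|
        ≤ Cd * M * exp (-(δ * ∑ i, (((y i - y₀ i).valMinAbs.natAbs : ℕ) : ℝ))) := fun y => by
      have h := blockMean_le_of_supProfile n a s ha.le hκ0 hκ1 hm hδ₁0 hδ₁κ h2δ₁ V hV ψ hψ y₀ u f hf hu y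
      have hρ : 0 ≤ ∑ i, (((y i - y₀ i).valMinAbs.natAbs : ℕ) : ℝ) := Finset.sum_nonneg fun _ _ => Nat.cast_nonneg _
      have hδe : exp (-(δ₁ * ∑ i, (((y i - y₀ i).valMinAbs.natAbs : ℕ) : ℝ))) ≤ exp (-(δ * ∑ i, (((y i - y₀ i).valMinAbs.natAbs : ℕ) : ℝ))) :=
        exp_le_exp.2 (by have := mul_le_mul_of_nonneg_right hδδ₁ hρ; linarith)
      rw [hCd]
      exact h.trans ((mul_le_mul_of_nonneg_left hδe (by positivity)).trans (le_of_eq (by ring)))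
    have hL1 : ∀ b : X d, ∑ q ∈ B n b, |u (siteOf d ((n + 1) * s) q)|
        ≤ ((n : ℝ) + 1) ^ d * Cd * M * exp (-(δ * ∑ i, ((((siteOf d s b) i - y₀ i).valMinAbs.natAbs : ℕ) : ℝ))) := fun b => by
      have h := blockL1_le_of_supProfile n a s ha.le hκ0 hκ1 hm hδ₁0 hδ₁κ h2δ₁ V hV y₀ u f hf hu (siteOf d s b)
      obtain ⟨t, ht⟩ := exists_windowMap_siteOf s b
      rw [← sum_B (windowMap d s (siteOf d s b)) (fun q => |u (siteOf d ((n + 1) * s) q)|), ht, sum_B_translate] at h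
      simp only [comp_siteOf_periodic] at h
      have hρ : 0 ≤ ∑ i, ((((siteOf d s b) i - y₀ i).valMinAbs.natAbs : ℕ) : ℝ) := Finset.sum_nonneg fun _ _ => Nat.cast_nonneg _
      have hδe : exp (-(δ₁ * ∑ i, ((((siteOf d s b) i - y₀ i).valMinAbs.natAbs : ℕ) : ℝ)))
          ≤ exp (-(δ * ∑ i, ((((siteOf d s b) i - y₀ i).valMinAbs.natAbs : ℕ) : ℝ))) :=
        exp_le_exp.2 (by have := mul_le_mul_of_nonneg_right hδδ₁ hρ; linarith)
      rw [hCd]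
      exact h.trans ((mul_le_mul_of_nonneg_left hδe (by positivity)).trans (le_of_eq (by ring)))
    set q₀ : X d := windowMap d ((n + 1) * s) x with hq₀
    have hnear : ∀ b : X d, (∀ i, blk n q₀ i - 1 ≤ b i ∧ b i ≤ blk n q₀ i + 1) →
        exp (-(δ * ∑ i, ((((siteOf d s b) i - y₀ i).valMinAbs.natAbs : ℕ) : ℝ))) ≤ E * exp (-(δ * ρx)) := fun b hb =>
      hfac (siteOf d s b) (near_dist_le s hb)
    obtain ⟨A, hA⟩ : ∃ A : ℝ, A = E * exp (-(δ * ρx)) * (M + L * (C₀ * M) + a * (Cd * M)) / ((n : ℝ) + 1) ^ 2 := ⟨_, rfl⟩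
    obtain ⟨Bsum, hB⟩ : ∃ Bsum : ℝ, Bsum = 3 ^ d * (((n : ℝ) + 1) ^ d * Cd * M * (E * exp (-(δ * ρx)))) := ⟨_, rfl⟩
    have hlap : ∀ p ∈ cube q₀ (3 * mm), |latticeLaplacianZd (fun p' : X d => u (siteOf d ((n + 1) * s) p')) p| ≤ A := by
      intro p hp
      rw [lap_lift, abs_neg]
      obtain ⟨⟨y', z'⟩, hyz'⟩ := siteOf_chart_surjective n s (siteOf d ((n + 1) * s) p)
      simp only at hyz'
      have hbt' : siteOf d s (blk n (windowMap d ((n + 1) * s) (siteOf d ((n + 1) * s) p))) = y' := by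
        rw [← hyz']; exact blockOf_siteOf_of_mem n s (mem_B.2 (blk_chart n (windowMap d s y') z'))
      have hy'b : y' = siteOf d s (blk n p) := by rw [← hbt', blockOf_siteOf]
      have hw : exp (-(δ * ∑ i, (((y' i - y₀ i).valMinAbs.natAbs : ℕ) : ℝ))) ≤ E * exp (-(δ * ρx)) := by
        rw [hy'b]; exact hnear (blk n p) (blk_near_of_mem_cube h3m hp)
      have hfx := hf (siteOf d ((n + 1) * s) p)
      have hux := hS (siteOf d ((n + 1) * s) p)
      rw [hbt'] at hfx hux
      rw [← hyz'] at hfx hux ⊢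
      have hρ' : 0 ≤ ∑ i, (((y' i - y₀ i).valMinAbs.natAbs : ℕ) : ℝ) := Finset.sum_nonneg fun _ _ => Nat.cast_nonneg _
      have hγδ : exp (-(γ * ∑ i, (((y' i - y₀ i).valMinAbs.natAbs : ℕ) : ℝ))) ≤ exp (-(δ * ∑ i, (((y' i - y₀ i).valMinAbs.natAbs : ℕ) : ℝ))) :=
        exp_le_exp.2 (by have := mul_le_mul_of_nonneg_right hδγ hρ'; linarith)
      have k1 : |f (siteOf d ((n + 1) * s) (chart n (windowMap d s y') z'))| ≤ M * (E * exp (-(δ * ρx))) :=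
        hfx.trans ((mul_le_mul_of_nonneg_left hγδ hM).trans (mul_le_mul_of_nonneg_left hw hM))
      have k2 : |u (siteOf d ((n + 1) * s) (chart n (windowMap d s y') z'))| ≤ E * exp (-(δ * ρx)) * (C₀ * M) :=
        hux.trans (mul_le_mul_of_nonneg_right hw (by positivity))
      have k3 : |(((n : ℝ) + 1) ^ d)⁻¹ * ∑ z : Fin d → Fin (n + 1), u (siteOf d ((n + 1) * s) (chart n (windowMap d s y') z))|
          ≤ Cd * M * (E * exp (-(δ * ρx))) := (hmean y').trans (mul_le_mul_of_nonneg_left hw (by positivity))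
      rw [hA]
      exact laplacian_site_le n a s ha.le hL0 V u f hu y' z' (hVabs _) k1 k2 k3
    have hl1 : ∑ p ∈ cube q₀ (3 * mm), |u (siteOf d ((n + 1) * s) p)| ≤ Bsum := by
      rw [hB]
      refine sum_cube_le_of_near h3m q₀ (F := fun p => |u (siteOf d ((n + 1) * s) p)|) (fun _ => abs_nonneg _) fun b hb => ?_
      exact (hL1 b).trans (mul_le_mul_of_nonneg_left (hnear b hb) (by positivity))
    have hint0 := (hI mm hmm1 (fun p' : X d => u (siteOf d ((n + 1) * s) p')) q₀ A Bsum hlap hl1).2 μ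
    have e2 : siteOf d ((n + 1) * s) q₀ = x := by rw [hq₀, siteOf_windowMap]
    have e3 : siteOf d ((n + 1) * s) (q₀ + Pi.single μ 1) = x + siteOf d ((n + 1) * s) (e μ) := by rw [siteOf_add, e2]; rfl
    have hint : |u (x + siteOf d ((n + 1) * s) (e μ)) - u x| ≤ CI * ((mm : ℝ) * A + Bsum / (mm : ℝ) ^ (d + 1)) := by rw [← e3, ← e2]; exact hint0
    have hX0 : 0 ≤ M + L * (C₀ * M) + a * (Cd * M) := by positivity
    have hmA : ((n : ℝ) + 1) * ((mm : ℝ) * A) ≤ E * exp (-(δ * ρx)) * ((1 / 3) * (M + L * (C₀ * M) + a * (Cd * M))) := by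
      have h2 : ((n : ℝ) + 1) * (mm : ℝ) / ((n : ℝ) + 1) ^ 2 ≤ 1 / 3 := by
        rw [div_le_iff₀ (by positivity)]; have := mul_le_mul_of_nonneg_left hmm_le hn1.le; linarith
      calc ((n : ℝ) + 1) * ((mm : ℝ) * A)
          = E * exp (-(δ * ρx)) * (((n : ℝ) + 1) * (mm : ℝ) / ((n : ℝ) + 1) ^ 2 * (M + L * (C₀ * M) + a * (Cd * M))) := by
            rw [hA]; ring
        _ ≤ _ := mul_le_mul_of_nonneg_left (mul_le_mul_of_nonneg_right h2 hX0) (by positivity)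
    have hmB : ((n : ℝ) + 1) * (Bsum / (mm : ℝ) ^ (d + 1)) ≤ E * exp (-(δ * ρx)) * (3 ^ d * Cd * 6 ^ (d + 1) * M) := by
      have hr : (n : ℝ) + 1 ≤ 6 * mm := by linarith
      have h1 : ((n : ℝ) + 1) ^ (d + 1) ≤ (6 : ℝ) ^ (d + 1) * (mm : ℝ) ^ (d + 1) := by rw [← mul_pow]; exact pow_le_pow_left₀ hn1.le hr _
      have h2 : ((n : ℝ) + 1) ^ (d + 1) / (mm : ℝ) ^ (d + 1) ≤ (6 : ℝ) ^ (d + 1) := by rwa [div_le_iff₀ (by positivity)]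
      calc ((n : ℝ) + 1) * (Bsum / (mm : ℝ) ^ (d + 1))
          = E * exp (-(δ * ρx)) * (3 ^ d * Cd * M * (((n : ℝ) + 1) ^ (d + 1) / (mm : ℝ) ^ (d + 1))) := by rw [hB, pow_succ]; ring
        _ ≤ E * exp (-(δ * ρx)) * (3 ^ d * Cd * M * (6 : ℝ) ^ (d + 1)) :=
            mul_le_mul_of_nonneg_left (mul_le_mul_of_nonneg_left h2 (by positivity)) (by positivity)
        _ = _ := by ring
    calc exp (δ * ρx) * (((n : ℝ) + 1) * |u (x + siteOf d ((n + 1) * s) (e μ)) - u x|)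
        ≤ exp (δ * ρx) * (((n : ℝ) + 1) * (CI * ((mm : ℝ) * A + Bsum / (mm : ℝ) ^ (d + 1)))) :=
          mul_le_mul_of_nonneg_left (mul_le_mul_of_nonneg_left hint hn1.le) (exp_pos _).le
      _ = exp (δ * ρx) * (CI * (((n : ℝ) + 1) * ((mm : ℝ) * A) + ((n : ℝ) + 1) * (Bsum / (mm : ℝ) ^ (d + 1)))) := by ring
      _ ≤ exp (δ * ρx) * (CI * (E * exp (-(δ * ρx)) * ((1 / 3) * (M + L * (C₀ * M) + a * (Cd * M)))
          + E * exp (-(δ * ρx)) * (3 ^ d * Cd * 6 ^ (d + 1) * M))) :=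
          mul_le_mul_of_nonneg_left (mul_le_mul_of_nonneg_left (add_le_add hmA hmB) hCI0) (exp_pos _).le
      _ = (exp (δ * ρx) * exp (-(δ * ρx))) * (K₂ * M) := by rw [hK₂]; ring
      _ = K₂ * M := by rw [hw0, one_mul]
      _ ≤ max K₁ K₂ * M := mul_le_mul_of_nonneg_right (le_max_right _ _) hM

/-! ## §4. Toy -/

/-- Toy (`d = 3`, `a = 1`, `λ = 0`, `Λ = 1`): the constant of §2 exists. -/
example : ∃ C : ℝ, 0 < C :=
  let ⟨C, hC, _⟩ := gradient_bound_road (d := 3) le_rfl 1 one_pos (lam := 0) (Lam := 1) (by norm_num) zero_le_one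
  ⟨C, hC⟩

end Summit.QuantumFields.BalabanUV.T4Continuum.NE7b.SupTorusGradientRoad
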